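import Summits.QuantumFields.YangMills.Theorems.BalabanLadderUVSeamRecCeilingsTemperedResponseCollar
import Summits.QuantumFields.YangMills.Theorems.BalabanLadderNTBoundaryLawStrongCoupling
import HarnessLib

/-!
# Crux `UVSeamRec` (stmt-QuantumFields-20043), stub `stub_ceilings` (E0′): the tempered-response collar PER COUPLING, and a
# proved rung — the body of `MomentBounds6` holds on every odd torus at STRONG coupling

Helper file (`--supports stmt-QuantumFields-20043`) of the width-lever seat `ym-20043-ceilings-p2` (lane B); sequel of
p530862 `…CeilingsTemperedResponseCollar.lean`.  HONEST FRAMING: §1 is bookkeeping (the route corollary of p530862 at ONE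
coupling, so that regimes other than `β ≥ β₁` can be packaged); §2 is an UNCONDITIONAL theorem but in the HIGH-TEMPERATURE
regime `|β| < β₁(G, r)` only — a format rung showing that the registered ceilings currency is inhabited by the actual Wilson
state in some regime; it says nothing about `β → ∞`, E0′, the seam or the gap; not Clay.

* §1 `abs_torusE_prod_sub_le_of_response` — at a fixed coupling `β`, on the odd torus `(ℤ/(2L+1))⁴` (`4R+8 ≤ L`, `1 ≤ R`),
  for cyclically `2R+4`-separated sites: a response law `|kerE_{cube i}(plane_i)(η) − p_i| ≤ ε(1 + Y_i(η))` for ALL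
  exteriors plus `⟨exp(Σ_{i∈T} Y_i∘lift)⟩ ≤ exp(B·#T)` for all `T` give `|⟨∏_i(plane_i − ⟨plane_i⟩)⟩| ≤ (ε(2+e^B)e^B)ⁿ`
  (p530862's engine on the radius-`R+1` cubes; the per-β form of `momentBounds6_of_temperedResponse`).
* §2 **`abs_torusE_prod_sub_le_smallBeta`** — for every compact `G` and lattice representation `r` there are `β₁ > 0`
  and `C ≥ 0` such that for `|β| < β₁`, on EVERY odd torus and every cyclically separated family (`1 ≤ R`, `4R+8 ≤ L`, no
  unit constraint), `|⟨∏_i(plane_i − ⟨plane_i⟩)⟩_{2L+1,β}| ≤ (C/R⁴)ⁿ` — the body of `MomentBounds6` VERBATIM, proved: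
  spine-19353 g6's strong-coupling oscillation bound `NT.BoundaryLaw.bl6osc_smallBeta` (Dobrushin–Shlosman at
  `|β| < β₁`) is a response law with `Y = 0`, reference values `p_i = kerE(plane_i)(η₀)` at the trivial exterior, and the
  centre of the radius-`R+1` cube has depth `R+2` (`depth_centred`).

References: H.-O. Georgii, *Gibbs Measures and Phase Transitions* (2011) Thm. 4.17, §8.1; R. L. Dobrushin, S. B. Shlosman
(1985) §2 (via p529847); K. Osterwalder, E. Seiler, Ann. Phys. 110 (1978) §4 (strong coupling).
-/

set_option autoImplicit false

noncomputable section

open MeasureTheory Filter Topology Finset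
open Literature.Probability.LatticeModels
open Literature.MathematicalPhysics.QuantumFieldTheory (GaugeConfig wilsonMeasure isProbabilityMeasure_wilsonMeasure
  measurable_torusLift LatticeRep)
open Literature.MathematicalPhysics.QuantumLattice

namespace Summit.QuantumFields.YangMills.Cruxes.UVSeamRec.TemperedResponse

open Summit.QuantumFields.YangMills.Cruxes.OSLegsFromFemtoAndGap.DlrCollarTransfer
open Summit.QuantumFields.YangMills.Cruxes.UV.TorusClass

variable {G : Type} [Group G] [TopologicalSpace G] [IsTopologicalGroup G] [CompactSpace G]
  [MeasurableSpace G] [BorelSpace G]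

/-! ## §1 The route corollary of the tempered-response collar at one coupling -/

/-- **Tempered-response ceilings at ONE coupling.**  On the odd torus `(ℤ/(2L+1))⁴` with `4R+8 ≤ L`, `1 ≤ R`, for
orientations `q i`, sites `x i` pairwise cyclically `2R+4`-separated in some coordinate, reference values `|p i| ≤ P₀`,
measurable bounded influence functionals `Y i ≥ 0`, `ε ≥ 0` and `B`: if for EVERY exterior `η`
`|kerE_{x i − (R+1), 2R+3}(plane (q i) (x i))(η) − p i| ≤ ε (1 + Y i η)` and for every index set `T`
`⟨exp(Σ_{i∈T} Y i∘lift)⟩_{2L+1,β} ≤ exp(B·#T)`, then `|⟨∏_i (plane_i − ⟨plane_i⟩)⟩_{2L+1,β}| ≤ (ε (2 + e^B) e^B)ⁿ`.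
Proof: p530862 `abs_integral_prod_sub_mean_le_of_response` on the radius-`R+1` cubes (geometry of the landed collar).
[folklore: Georgii (2011) Thm. 4.17 for the DLR part] -/
theorem abs_torusE_prod_sub_le_of_response (r : LatticeRep G) (β : ℝ) {L n : ℕ} (q : Fin n → Fin 4 × Fin 4)
    (x : Fin n → (Fin 4 → ℤ)) {R : ℕ} (hR : 1 ≤ R) (hRL : 4 * R + 8 ≤ L)
    (hsep : ∀ i j : Fin n, i ≠ j → ∃ k : Fin 4,
      (2 * (R : ℤ) + 4) ≤ |((((x i k - x j k : ℤ) : ZMod (2 * L + 1))).valMinAbs : ℤ)|)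
    (p : Fin n → ℝ) {P₀ : ℝ} (hp : ∀ i, |p i| ≤ P₀)
    (Y : Fin n → LGConfig 4 G → ℝ) (hYm : ∀ i, Measurable (Y i)) (hY0 : ∀ i η, 0 ≤ Y i η)
    {MY : ℝ} (hYb : ∀ i η, Y i η ≤ MY) {ε B : ℝ} (hε : 0 ≤ ε)
    (hlaw : ∀ (i : Fin n) (η : LGConfig 4 G),
      |kerE G r β (fun k => x i k - (R + 1)) (2 * R + 3) η (plane G r (q i) (x i)) - p i| ≤ ε * (1 + Y i η))
    (hEM : ∀ T : Finset (Fin n),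
      torusE G r β L (fun U => Real.exp (∑ i ∈ T, Y i U)) ≤ Real.exp (B * T.card)) :
    |torusE G r β L (fun U => ∏ i, (plane G r (q i) (x i) U - torusE G r β L (plane G r (q i) (x i))))| ≤
      (ε * ((2 + Real.exp B) * Real.exp B)) ^ n := by
  haveI : SecondCountableTopology G :=
    (r.continuous.isClosedEmbedding r.injective).isEmbedding.secondCountableTopology
  obtain ⟨CA, hCA⟩ := exists_abs_plane_le r
  haveI := isProbabilityMeasure_wilsonMeasure (d := 4) (L := 2 * L + 1) r.ρ r.continuous β
  rcases Nat.eq_zero_or_pos n with hn | hn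
  · subst hn
    simp [torusE]
  obtain ⟨i₀⟩ : Nonempty (Fin n) := ⟨⟨0, hn⟩⟩
  have hP₀ : 0 ≤ P₀ := (abs_nonneg _).trans (hp i₀)
  have hmeas : ∀ i : Fin n, Measurable (plane G r (q i) (x i)) := fun i =>
    (continuous_plane r (q i) (x i)).measurable
  have hAc : ∀ i : Fin n, Continuous fun U => plane G r (q i) (x i) U - p i := fun i =>
    (continuous_plane r (q i) (x i)).sub continuous_const
  have hAb : ∀ (i : Fin n) (U : LGConfig 4 G), |plane G r (q i) (x i) U - p i| ≤ CA + P₀ :=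
    fun i U => (abs_sub _ _).trans (add_le_add (hCA _ _ _) (hp _))
  have hAS : ∀ i : Fin n, IsCylinder (fun U => plane G r (q i) (x i) U - p i)
      (cubeEdges (fun k => x i k - (R + 1)) (2 * R + 3)) :=
    fun i U V hUV => by simp only [isCylinder_plane_cube r hR (q i) (x i) hUV]
  have hinj : ∀ i : Fin n, Set.InjOn (Torus.proj (2 * L + 1))
      (((cubeEdges (fun k => x i k - (R + 1)) (2 * R + 3) ∪ cubeEdges (fun k => x i k - (R + 1)) (2 * R + 3) ∪
          (plaquettesTouching (cubeEdges (fun k => x i k - (R + 1)) (2 * R + 3))).biUnion plaquetteEdges).image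
          Prod.fst : Set (Fin 4 → ℤ))) := fun i => injOn_torusProj_cube hRL (x i)
  have hfar : ∀ i j : Fin n, i ≠ j → ∀ e ∈ cubeEdges (fun k => x j k - (R + 1)) (2 * R + 3) ∪
      (plaquettesTouching (cubeEdges (fun k => x j k - (R + 1)) (2 * R + 3))).biUnion plaquetteEdges,
      ∀ e' ∈ cubeEdges (fun k => x i k - (R + 1)) (2 * R + 3),
      torusEdge (2 * L + 1) e ≠ torusEdge (2 * L + 1) e' :=
    fun i j hij e he e' he' => torusEdge_ne_cube (hsep i j hij) he he'
  have hm : ∀ i : Fin n, torusE G r β L (plane G r (q i) (x i)) - p i =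
      ∫ W, (plane G r (q i) (x i) (torusLift (2 * L + 1) W) - p i)
        ∂(wilsonMeasure (d := 4) (L := 2 * L + 1) r.ρ β) := fun i =>
    (integral_sub_const_of_abs_le (μ := wilsonMeasure (d := 4) (L := 2 * L + 1) r.ρ β)
      ((continuous_plane r (q i) (x i)).comp (continuous_torusLift (2 * L + 1))).measurable
      (fun W => hCA (q i) (x i) (torusLift (2 * L + 1) W)) (p i)).symm
  have hker : ∀ (i : Fin n) (η : LGConfig 4 G),
      |(∫ U, (plane G r (q i) (x i) U - p i) ∂(ymSpecification r.ρ β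
        (cubeEdges (fun k => x i k - (R + 1)) (2 * R + 3)) η)) - 0| ≤ ε * (1 + Y i η) := fun i η => by
    haveI := isProbabilityMeasure_ymSpecification r.ρ r.continuous β
      (cubeEdges (fun k => x i k - (R + 1)) (2 * R + 3)) η
    rw [sub_zero, integral_sub_const_of_abs_le (hmeas i) (fun U => hCA (q i) (x i) U) (p i)]
    exact hlaw i η
  have hmom : ∀ T : Finset (Fin n),
      ∫ V, Real.exp (∑ i ∈ T, Y i (torusLift (2 * L + 1) V))
        ∂(wilsonMeasure (d := 4) (L := 2 * L + 1) r.ρ β) ≤ Real.exp (B * T.card) := fun T => hEM T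
  have key := abs_integral_prod_sub_mean_le_of_response (d := 4) r.ρ r.continuous β (L := 2 * L + 1) (n := n)
      (fun i => cubeEdges (fun k => x i k - (R + 1)) (2 * R + 3))
      (fun i => cubeEdges (fun k => x i k - (R + 1)) (2 * R + 3))
      (fun i U => plane G r (q i) (x i) U - p i) hAc hAb hAS hinj hfar
      (fun i => torusE G r β L (plane G r (q i) (x i)) - p i) hm
      Y hYm hY0 (MY := MY) hYb (p := 0) (ε := ε) (B := B) hε hker hmom
  simp only [sub_sub_sub_cancel_right] at key
  exact key

/-! ## §2 A proved rung: the body of `MomentBounds6` at strong coupling, on every odd torus -/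

/-- The centre of the radius-`R+1` cube around `x` has depth `R+2 ≥ R`, so a `C₁/depth⁴` law there is a `C₁/R⁴` law.
[folklore] -/
theorem div_depth_centred_pow_le {C₁ : ℝ} (hC₁ : 0 ≤ C₁) (x : Fin 4 → ℤ) {R : ℕ} (hR : 1 ≤ R) :
    C₁ / (depth (fun k => x k - (R + 1)) (2 * R + 3) x : ℝ) ^ 4 ≤ C₁ / (R : ℝ) ^ 4 := by
  rw [depth_centred]
  have hR0 : (0 : ℝ) < R := by exact_mod_cast (show 0 < R by omega)
  refine div_le_div_of_nonneg_left hC₁ (by positivity) ?_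
  gcongr
  linarith

/-- **The body of `MomentBounds6` holds at strong coupling, unconditionally, on every odd torus.**  For every compact
group `G` and lattice representation `r` there are `β₁ > 0` and `C ≥ 0` such that for `|β| < β₁`, every odd torus
`(ℤ/(2L+1))⁴`, every `n`, orientations `q i`, sites `x i` and radius `R` with `1 ≤ R`, `4R+8 ≤ L` and pairwise cyclic
`2R+4`-separation in some coordinate:
`|⟨∏_i (plane (q i) (x i) − ⟨plane (q i) (x i)⟩)⟩_{2L+1,β}| ≤ (C/R⁴)ⁿ` — the registered ceilings currency's body VERBATIM
(no unit constraint is needed in this regime).  Proof: the Dobrushin–Shlosman strong-coupling oscillation bound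
`NT.BoundaryLaw.bl6osc_smallBeta` (p529847) is a response law with `Y = 0` about the reference values
`p_i = kerE(plane_i)(η₀)` at the trivial exterior; §1 with `B = 0`; `C = 3C₁`.  A format rung only: it says nothing
about `β → ∞`. [folklore: Osterwalder–Seiler (1978) §4 regime; Dobrushin–Shlosman (1985)] -/
theorem abs_torusE_prod_sub_le_smallBeta (r : LatticeRep G) :
    ∃ β₁ : ℝ, 0 < β₁ ∧ ∃ C : ℝ, 0 ≤ C ∧ ∀ β : ℝ, |β| < β₁ →
      ∀ (L n : ℕ) (q : Fin n → Fin 4 × Fin 4) (x : Fin n → (Fin 4 → ℤ)) (R : ℕ), 1 ≤ R → 4 * R + 8 ≤ L →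
      (∀ i j : Fin n, i ≠ j → ∃ k : Fin 4,
        (2 * (R : ℤ) + 4) ≤ |((((x i k - x j k : ℤ) : ZMod (2 * L + 1))).valMinAbs : ℤ)|) →
      |torusE G r β L (fun U => ∏ i, (plane G r (q i) (x i) U - torusE G r β L (plane G r (q i) (x i))))| ≤
        (C / (R : ℝ) ^ 4) ^ n := by
  obtain ⟨β₁, hβ₁, C₁, hC₁, H⟩ := Summit.QuantumFields.YangMills.Cruxes.NT.BoundaryLaw.bl6osc_smallBeta G r
  obtain ⟨CA, hCA⟩ := exists_abs_plane_le r
  refine ⟨β₁, hβ₁, 3 * C₁, by positivity, ?_⟩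
  intro β hβ L n q x R hR hRL hsep
  haveI : SecondCountableTopology G :=
    (r.continuous.isClosedEmbedding r.injective).isEmbedding.secondCountableTopology
  haveI := isProbabilityMeasure_wilsonMeasure (d := 4) (L := 2 * L + 1) r.ρ r.continuous β
  -- reference values: the kernel means at the trivial exterior
  set η₀ : LGConfig 4 G := fun _ => 1 with hη₀
  set p : Fin n → ℝ := fun i => kerE G r β (fun k => x i k - (R + 1)) (2 * R + 3) η₀ (plane G r (q i) (x i))
    with hpdef
  have hp : ∀ i, |p i| ≤ CA := fun i =>
    abs_integral_ymSpecification_le r.ρ r.continuous β _ (hCA (q i) (x i)) η₀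
  -- the strong-coupling oscillation bound is a response law with `Y = 0`
  have hlaw : ∀ (i : Fin n) (η : LGConfig 4 G),
      |kerE G r β (fun k => x i k - (R + 1)) (2 * R + 3) η (plane G r (q i) (x i)) - p i| ≤
        C₁ / (R : ℝ) ^ 4 * (1 + (fun _ : LGConfig 4 G => (0 : ℝ)) η) := by
    intro i η
    rw [add_zero, mul_one]
    have hd : 1 ≤ depth (fun k => x i k - (R + 1)) (2 * R + 3) (x i) := by rw [depth_centred]; omega
    exact (H β hβ (q i) _ _ η η₀ (x i) hd).trans (div_depth_centred_pow_le hC₁ (x i) hR)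
  have hEM : ∀ T : Finset (Fin n),
      torusE G r β L (fun U => Real.exp (∑ i ∈ T, (fun _ : LGConfig 4 G => (0 : ℝ)) U)) ≤
        Real.exp (0 * T.card) := fun T => by
    simp only [Finset.sum_const_zero, Real.exp_zero, zero_mul, torusE, integral_const, smul_eq_mul, mul_one]
    simp
  have key := abs_torusE_prod_sub_le_of_response r β q x hR hRL hsep p hp (fun _ _ => (0 : ℝ))
    (fun _ => measurable_const) (fun _ _ => le_rfl) (MY := 0) (fun _ _ => le_rfl) (ε := C₁ / (R : ℝ) ^ 4)
    (B := 0) (by positivity) hlaw hEM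
  refine key.trans (le_of_eq ?_)
  rw [Real.exp_zero]
  ring

end Summit.QuantumFields.YangMills.Cruxes.UVSeamRec.TemperedResponse

end
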